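/-
Copyright (c) 2026 the pub-hodgecm-mathlib formalisation cell (harness21).  Prover seat hodgecm-mathlib-K2E1-p08 (g6), Track B ∕ K2-LIT
(build stream 29), h413 = `stmt-HodgeConjecture-24833`, line `K2_E1_TraceFormulaBeta`, campaign «EIS-R7-BL-SPH-2» (Bernstein–Lapid soft continuation of
the spherical Borel Eisenstein series), file «P2a-ι §4bis» sequel (every rank): P2b's disintegration letter `hdis`; dealer K2E1-plan (g5) 2026-09-04T09:07:50Z.
-/
import Summits.HodgeConjecture.HodgeConjecture.Theorems.K2E1BLQuotientMeasureU               -- ★ (this seat): Bochner unfolding of `wtm_{k,c} μZ`, `μZ = π_*(β ν_G)`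
import Summits.HodgeConjecture.HodgeConjecture.Theorems.K2E1BorelWeightAverage              -- ★ (K2E4-p11 g3) AVG: `∫ wt β • F_B = ∫ wt β • F` for left-`B(F)`-invariant `F` (+ `_two`, `_three` letters)
import HarnessLib

/-!
# h413 ∕ Track B «K2-LIT», campaign «EIS-R7-BL-SPH-2» — helper `K2E1BLFibreAverageInvarianceU` («P2a-ι §4bis» sequel, EVERY RANK): THE WEIGHTED TRUNCATED MEASURE
# `wtm_{k,c} μZ` ON `Z = B(F)∖G(𝔸)` IS INVARIANT UNDER THE FIBRE AVERAGE `Φ ↦ Φ_B` — P2b's disintegration letter `hdis` is a theorem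

Cell `pub/hodgecm-mathlib`, crux H413 = `stmt-HodgeConjecture-24833`, route of record `HCCMUnconditional`; chair K2-lead (g1), dealer K2E1-plan (g5) (09:07:50Z: «P2b FILE A … `hdis` = μw invariant
under fibre averaging (K2E1-p08 discharges from `hμZ`+`hβ`)»; K2-defs1 (g5) P2b-A heads 09:07:36Z: `hdis : ∀ Φ, (∀ b ∈ ratBorelSubgroup, ∀ g, Φ (b*g) = Φ g) → Integrable (zFun Φ) μw →
Integrable (zFun (borelConstantTerm ν 𝓕 Φ)) μw → ∫ zFun (borelConstantTerm ν 𝓕 Φ) ∂μw = ∫ zFun Φ ∂μw`).  THEOREMS ONLY (no `def`, no `instance`, no `notation`, no named-fact hypothesis, no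
`sorry`); lane `--kind proof --supports stmt-HodgeConjecture-24833 --as helper` (count-neutral).  Currency of ★ leaf 1 ED. 2 `K2E1BLBorelSpacesU2Defs` and ★ `K2E1BLQuotientMeasureU` (letters
`hμZ`, `hβ`; `μw = wtm_{k,c} μZ = weightedTruncMeasure k c μZ`); ★ AVG `K2E1BorelWeightAverage` supplies the unfolded identity on `𝔾` under its structural letters `(ν_N) [IsHaarMeasure]
[IsInvInvariant] (hconj) (h𝓕) (h𝓕₀) (h𝓕top)` (the product-formula conjugation invariance `hconj` is ★ at `N = 2, 3`: `map_conj_toAdelic_eq_self_two ∕ _three`).  One extra binder w.r.t. the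
letter as first posted: `Φ` BOREL on `𝔾` (`hΦm`) — ★ AVG integrates a Borel `F`.

* §1 `truncWeightReal` algebra: `measurable_truncWeightReal`, `truncWeightReal_unipotent_mul` ∕ `_arithmeticBorel_mul` (the real weight `ρ = 𝟙_{c<H} H^{−2k}` is Borel and left-`N(𝔸)B(F)`-invariant),
  **`borelConstantTerm_truncWeightReal_smul`** (PULL-OUT `(ρ • Φ)_B = ρ • Φ_B`), `integrable_wt_smul_truncWeightReal_smul_of_integrable_zFun` (the `wtm`-integrability of `zFun Φ` IS the
  `ν_G`-integrability of `wt β • (ρ • Φ)`: Mathlib `integrable_withDensity_iff_integrable_coe_smul`, `integrable_indicator_iff`, `integrable_map_measure` along ★ `μZ = π_*(β ν_G)`), and its `L¹` form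
  `lintegral_wt_mul_enorm_truncWeightReal_smul_lt_top`.
* §2 **`integral_zFun_borelConstantTerm_eq_of_unfolding`** — for Borel left-`B(F)`-invariant `Φ : 𝔾 → ℂ` with `zFun Φ`, `zFun Φ_B` integrable w.r.t. `wtm_{k,c} μZ`:
  **`∫_Z zFun Φ_B d(wtm) = ∫_Z zFun Φ d(wtm)`** (both sides unfold by ★ `integral_weightedTruncMeasure_eq_of_unfolding` to `∫_𝔾 wt β • (ρ • Ψ)`, `Ψ ∈ {Φ_B, Φ}` — `zFun Ψ (π g) = Ψ g` as both are
  left-`B(F)`-invariant, ★ `borelConstantTerm_rational_borel_mul` —, the pull-out turns `ρ • Φ_B` into `(ρ • Φ)_B`, and ★ AVG `integral_wt_smul_borelConstantTerm_eq_of` closes); the instances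
  **`…_two`** (`U(J₂)`, `c² = 1`, `c ≠ 1`) and **`…_three`** (`U(J₃)`) with `hconj` discharged.

HONEST LABEL.  Count-neutral helper of the BL-SPH-2 template (consumer: P2b-A `K2E1BLConstantTermProjectionU2` (K2-defs1) — its `hdis`; K1-L² (K2E1-p11) through P2b); closes no socket; HC_CM is
proved only modulo the 7 printed citations (2 remaining named inputs: hLiu418 = `stmt-HodgeConjecture-24832`, h413 = `stmt-HodgeConjecture-24833`) until rung 0 closes.

## References
* [MoeglinWaldspurger1995] C. Mœglin, J.-L. Waldspurger, *Spectral Decomposition and Eisenstein Series* (1995), I.2.6 (constant terms), II.1.7–II.1.8 (the constant term in the unfolded pairing).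
* [BernsteinLapid2019] J. Bernstein, E. Lapid, *On the meromorphic continuation of Eisenstein series*, J. Amer. Math. Soc. 37 (2024) (arXiv:1911.02342), §4 Claim 4 (p. 10).
* [Rogawski1990] J. D. Rogawski, *Automorphic Representations of Unitary Groups in Three Variables* (1990), §2.1 (`φ_P`).
-/

set_option autoImplicit false
-- the mandated namespace repeats `HodgeConjecture.HodgeConjecture`, as in every `Theorems/*.lean` of this sub-problem
set_option linter.dupNamespace false

noncomputable section

open MeasureTheory MeasureTheory.Measure Set NumberField IsDedekindDomain Filter Topology
open scoped NNReal ENNReal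
open Literature.MeasureTheory.Group Literature.NumberTheory.Automorphic Literature.NumberTheory.Automorphic.UnitaryGroup AdelicGroupData
open Summit.HodgeConjecture.HodgeConjecture.Cruxes.H413.K2E1BLBorelSpacesU2Defs
open Summit.HodgeConjecture.HodgeConjecture.Cruxes.H413.K2E1BLIotaUnfoldingU
open Summit.HodgeConjecture.HodgeConjecture.Cruxes.H413.K2E1BLQuotientMeasureU
open Summit.HodgeConjecture.HodgeConjecture.Cruxes.H413.K2E1BorelWeightAverage

namespace Summit.HodgeConjecture.HodgeConjecture.Cruxes.H413.K2E1BLFibreAverageInvarianceU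

variable {F E : Type} [Field F] [NumberField F] [Field E] [NumberField E] [Algebra F E] {c : E ≃ₐ[F] E} {N : ℕ} [NeZero N]

/-! ## §1 The real weight `ρ = 𝟙_{c<H} H^{−2k}`: measurability, invariance, pull-out, and the integrability transport -/

/-- `ρ(b y) = ρ(y)` for `b ∈ B(F)` (`H` is left-`B(F)`-invariant ★, product formula). [cite: MoeglinWaldspurger1995, I.2.6] -/
theorem truncWeightReal_arithmeticBorel_mul (k : ℕ) (c₀ : ℝ≥0) {b : (quasiSplit F E c N).arithmeticSubgroup} (hb : b ∈ arithmeticBorel F E c N) (y : (quasiSplit F E c N).Adelic) :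
    {y : (quasiSplit F E c N).Adelic | c₀ < borelHeight y}.indicator (fun y => (((borelHeight y)⁻¹ ^ (2 * k) : ℝ≥0) : ℝ)) ((b : (quasiSplit F E c N).Adelic) * y) =
      {y : (quasiSplit F E c N).Adelic | c₀ < borelHeight y}.indicator (fun y => (((borelHeight y)⁻¹ ^ (2 * k) : ℝ≥0) : ℝ)) y := by
  simp only [Set.indicator, Set.mem_setOf_eq, borelHeight_arithmeticBorel_mul' hb]

/-- **PULL-OUT**: `(H^{−2k} • 𝟙_{c<H} Φ)_B = H^{−2k} • 𝟙_{c<H} Φ_B` — the weight `H^{−2k}` and the cut-off `{c < H}` are left-`N(𝔸)`-invariant (★ `borelHeight_unipotent_mul`), so they pass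
through the fibre average `Φ_B(g) = (ν𝓕)⁻¹ • ∫_𝓕 Φ(u g) dν(u)`. [cite: MoeglinWaldspurger1995, I.2.6] [cite: Rogawski1990, §2.1] -/
theorem borelConstantTerm_heightPow_smul_indicator [MeasurableSpace ↥(adelicUnipotent F E c N)]
    (νN : Measure ↥(adelicUnipotent F E c N)) (𝓕 : Set ↥(adelicUnipotent F E c N)) (k : ℕ) (c₀ : ℝ≥0)
    (Φ : (quasiSplit F E c N).Adelic → ℂ) (g : (quasiSplit F E c N).Adelic) :
    borelConstantTerm νN 𝓕 (fun y => (((borelHeight y)⁻¹ ^ (2 * k) : ℝ≥0) : ℝ) • {y : (quasiSplit F E c N).Adelic | c₀ < borelHeight y}.indicator Φ y) g =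
      (((borelHeight g)⁻¹ ^ (2 * k) : ℝ≥0) : ℝ) • {y : (quasiSplit F E c N).Adelic | c₀ < borelHeight y}.indicator (borelConstantTerm νN 𝓕 Φ) g := by
  have hH : ∀ (u : ↥(adelicUnipotent F E c N)) (y : (quasiSplit F E c N).Adelic), borelHeight ((u : (quasiSplit F E c N).Adelic) * y) = borelHeight y :=
    fun u y => borelHeight_unipotent_mul u.2 y
  by_cases hg : c₀ < borelHeight g
  · have hg' : g ∈ {y : (quasiSplit F E c N).Adelic | c₀ < borelHeight y} := hg
    have hu : ∀ u : ↥(adelicUnipotent F E c N), (u : (quasiSplit F E c N).Adelic) * g ∈ {y : (quasiSplit F E c N).Adelic | c₀ < borelHeight y} := fun u => by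
      show c₀ < borelHeight _
      rw [hH]
      exact hg
    have e : ∀ u : ↥(adelicUnipotent F E c N),
        (((borelHeight ((u : (quasiSplit F E c N).Adelic) * g))⁻¹ ^ (2 * k) : ℝ≥0) : ℝ) • {y : (quasiSplit F E c N).Adelic | c₀ < borelHeight y}.indicator Φ ((u : (quasiSplit F E c N).Adelic) * g) =
          (((borelHeight g)⁻¹ ^ (2 * k) : ℝ≥0) : ℝ) • Φ ((u : (quasiSplit F E c N).Adelic) * g) := fun u => by
      rw [hH, Set.indicator_of_mem (hu u)]
    rw [Set.indicator_of_mem hg', borelConstantTerm_def, borelConstantTerm_def]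
    simp only [e, integral_smul]
    rw [smul_comm]
  · have hg' : g ∉ {y : (quasiSplit F E c N).Adelic | c₀ < borelHeight y} := hg
    have hu : ∀ u : ↥(adelicUnipotent F E c N), (u : (quasiSplit F E c N).Adelic) * g ∉ {y : (quasiSplit F E c N).Adelic | c₀ < borelHeight y} := fun u => by
      show ¬ c₀ < borelHeight _
      rw [hH]
      exact hg
    have e : ∀ u : ↥(adelicUnipotent F E c N),
        (((borelHeight ((u : (quasiSplit F E c N).Adelic) * g))⁻¹ ^ (2 * k) : ℝ≥0) : ℝ) • {y : (quasiSplit F E c N).Adelic | c₀ < borelHeight y}.indicator Φ ((u : (quasiSplit F E c N).Adelic) * g) = 0 :=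
      fun u => by rw [Set.indicator_of_notMem (hu u), smul_zero]
    rw [Set.indicator_of_notMem hg', smul_zero, borelConstantTerm_def]
    simp only [e, integral_zero, smul_zero]

/-- The normal form: `𝟙_{c<H}(ρ₀ • Φ) = ρ₀ • 𝟙_{c<H} Φ` pointwise (`ρ₀ = H^{−2k}`). [cite: BernsteinLapid2019, §4 p. 10] -/
theorem indicator_heightPow_smul_apply (k : ℕ) (c₀ : ℝ≥0) (Φ : (quasiSplit F E c N).Adelic → ℂ) (g : (quasiSplit F E c N).Adelic) :
    {y : (quasiSplit F E c N).Adelic | c₀ < borelHeight y}.indicator (fun y => (((borelHeight y)⁻¹ ^ (2 * k) : ℝ≥0) : ℝ) • Φ y) g =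
      (((borelHeight g)⁻¹ ^ (2 * k) : ℝ≥0) : ℝ) • {y : (quasiSplit F E c N).Adelic | c₀ < borelHeight y}.indicator Φ g := by
  by_cases hg : g ∈ {y : (quasiSplit F E c N).Adelic | c₀ < borelHeight y}
  · rw [Set.indicator_of_mem hg, Set.indicator_of_mem hg]
  · rw [Set.indicator_of_notMem hg, Set.indicator_of_notMem hg, smul_zero]

variable [MeasurableSpace (quasiSplit F E c N).Adelic] [BorelSpace (quasiSplit F E c N).Adelic]

/-- The real weight `ρ = 𝟙_{c<H} H^{−2k}` on `𝔾` is Borel. [cite: BernsteinLapid2019, §4 p. 10] -/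
theorem measurable_truncWeightReal (k : ℕ) (c₀ : ℝ≥0) :
    Measurable fun y : (quasiSplit F E c N).Adelic => {y : (quasiSplit F E c N).Adelic | c₀ < borelHeight y}.indicator (fun y => (((borelHeight y)⁻¹ ^ (2 * k) : ℝ≥0) : ℝ)) y := by
  have hH : Measurable (borelHeight : (quasiSplit F E c N).Adelic → ℝ≥0) := continuous_borelHeight.measurable
  exact ((hH.inv.pow_const _).coe_nnreal_real).indicator (measurableSet_lt measurable_const hH)

/-- **INTEGRABILITY TRANSPORT**: for left-`B(F)`-invariant `Φ`, the `wtm_{k,c} μZ`-integrability of `zFun Φ` IS the `ν_G`-integrability of `(β g).toReal • (ρ g • Φ g)` (`wtm` is a `withDensity`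
of a restriction, Mathlib `integrable_withDensity_iff_integrable_coe_smul` ∕ `integrable_indicator_iff`; `μZ = π_*(β ν_G)` ★ and `integrable_map_measure`; `zFun Φ (π g) = Φ g`).
[cite: BernsteinLapid2019, §4 p. 10] -/
theorem integrable_wt_smul_truncWeightReal_smul_of_integrable_zFun (νG : Measure (quasiSplit F E c N).Adelic)
    {β : (quasiSplit F E c N).Adelic → ℝ≥0∞} (hβ : IsCoveringWeight ↥((arithmeticBorel F E c N).map (quasiSplit F E c N).arithmeticSubgroup.subtype) β)
    {μZ : Measure (borelQuotient F E c N)}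
    (hμZ : ∀ f : borelQuotient F E c N → ℝ≥0∞, Measurable f → ∫⁻ z, f z ∂μZ = ∫⁻ g, β g * f (toBorelQuotient F E c N g) ∂νG)
    (k : ℕ) (c₀ : ℝ≥0) {Φ : (quasiSplit F E c N).Adelic → ℂ}
    (hΦB : ∀ b ∈ ratBorelSubgroup F E c N, ∀ g : (quasiSplit F E c N).Adelic, Φ (b * g) = Φ g)
    (hint : Integrable (zFun F E c N Φ) (weightedTruncMeasure F E c N k c₀ μZ)) :
    Integrable (fun g => (β g).toReal • ((((borelHeight g)⁻¹ ^ (2 * k) : ℝ≥0) : ℝ) • {y : (quasiSplit F E c N).Adelic | c₀ < borelHeight y}.indicator Φ g)) νG := by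
  have hS : MeasurableSet {z : borelQuotient F E c N | c₀ < borelQuotHeight F E c N z} := measurableSet_lt measurable_const measurable_borelQuotHeight
  have hdNN : Measurable fun z : borelQuotient F E c N => ((borelQuotHeight F E c N z)⁻¹ ^ (2 * k) : ℝ≥0) := measurable_borelQuotHeight.inv.pow_const _
  -- Step 1: `wtm`-integrability = `μZ|_S`-integrability of `d • zFun Φ` = `μZ`-integrability of the indicator
  have h1 : Integrable (fun z => ((borelQuotHeight F E c N z)⁻¹ ^ (2 * k) : ℝ) • zFun F E c N Φ z)
      (μZ.restrict {z : borelQuotient F E c N | c₀ < borelQuotHeight F E c N z}) := by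
    rw [weightedTruncMeasure] at hint
    have h := (integrable_withDensity_iff_integrable_coe_smul hdNN).1 hint
    simpa only [NNReal.coe_pow, NNReal.coe_inv] using h
  have h2 : Integrable ({z : borelQuotient F E c N | c₀ < borelQuotHeight F E c N z}.indicator
      fun z => ((borelQuotHeight F E c N z)⁻¹ ^ (2 * k) : ℝ) • zFun F E c N Φ z) μZ :=
    (integrable_indicator_iff hS).2 h1
  -- Step 2: transport along `μZ = π_*(β ν_G)`
  have hmap := map_toBorelQuotient_withDensity_eq_of_unfolding νG hβ hμZ
  rw [← hmap] at h2
  have h3 := (integrable_map_measure h2.aestronglyMeasurable (continuous_toBorelQuotient F E c N).measurable.aemeasurable).1 h2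
  -- Step 3: `withDensity β` → `(β g).toReal •`
  have h4 := (integrable_withDensity_iff_integrable_smul' hβ.measurable (Eventually.of_forall fun g => lt_of_le_of_lt (hβ.le_one g) ENNReal.one_lt_top)).1 h3
  refine h4.congr (Eventually.of_forall fun g => ?_)
  -- pointwise: the indicator at `π g` is `ρ g • Φ g`
  simp only [Function.comp_apply]
  congr 1
  by_cases hg : c₀ < borelHeight g
  · have hmem : toBorelQuotient F E c N g ∈ {z : borelQuotient F E c N | c₀ < borelQuotHeight F E c N z} := hg
    have hmem' : g ∈ {y : (quasiSplit F E c N).Adelic | c₀ < borelHeight y} := hg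
    rw [Set.indicator_of_mem hmem, Set.indicator_of_mem hmem', zFun_toBorelQuotient F E c N hΦB, borelQuotHeight_toBorelQuotient, NNReal.coe_pow, NNReal.coe_inv]
  · have hmem : toBorelQuotient F E c N g ∉ {z : borelQuotient F E c N | c₀ < borelQuotHeight F E c N z} := hg
    have hmem' : g ∉ {y : (quasiSplit F E c N).Adelic | c₀ < borelHeight y} := hg
    rw [Set.indicator_of_notMem hmem, Set.indicator_of_notMem hmem', smul_zero]

/-- The `L¹` form: `∫⁻ β · ‖ρ • Φ‖ₑ dν_G < ∞` (the hypothesis `hL1` of ★ AVG). [cite: BernsteinLapid2019, §4 p. 10] -/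
theorem lintegral_wt_mul_enorm_truncWeightReal_smul_lt_top (νG : Measure (quasiSplit F E c N).Adelic)
    {β : (quasiSplit F E c N).Adelic → ℝ≥0∞} (hβ : IsCoveringWeight ↥((arithmeticBorel F E c N).map (quasiSplit F E c N).arithmeticSubgroup.subtype) β)
    {μZ : Measure (borelQuotient F E c N)}
    (hμZ : ∀ f : borelQuotient F E c N → ℝ≥0∞, Measurable f → ∫⁻ z, f z ∂μZ = ∫⁻ g, β g * f (toBorelQuotient F E c N g) ∂νG)
    (k : ℕ) (c₀ : ℝ≥0) {Φ : (quasiSplit F E c N).Adelic → ℂ}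
    (hΦB : ∀ b ∈ ratBorelSubgroup F E c N, ∀ g : (quasiSplit F E c N).Adelic, Φ (b * g) = Φ g)
    (hint : Integrable (zFun F E c N Φ) (weightedTruncMeasure F E c N k c₀ μZ)) :
    ∫⁻ g, β g * ‖(((borelHeight g)⁻¹ ^ (2 * k) : ℝ≥0) : ℝ) • {y : (quasiSplit F E c N).Adelic | c₀ < borelHeight y}.indicator Φ g‖ₑ ∂νG < ∞ := by
  have h := (integrable_wt_smul_truncWeightReal_smul_of_integrable_zFun νG hβ hμZ k c₀ hΦB hint).2
  rw [hasFiniteIntegral_iff_enorm] at h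
  refine lt_of_le_of_lt (le_of_eq (lintegral_congr fun g => ?_)) h
  rw [K2E1IntertwiningAdjointEngine.enorm_toReal_smul (ne_top_of_le_ne_top ENNReal.one_ne_top (hβ.le_one g))]

/-! ## §2 P2b's disintegration letter `hdis` is a theorem -/

/-- **`wtm_{k,c} μZ` IS INVARIANT UNDER THE FIBRE AVERAGE `Φ ↦ Φ_B`** (every rank, under ★ AVG's conjugation letter `hconj`): for Borel left-`B(F)`-invariant `Φ : 𝔾 → ℂ` with `zFun Φ` and `zFun Φ_B`
integrable w.r.t. `wtm_{k,c} μZ`, **`∫_Z zFun Φ_B d(wtm) = ∫_Z zFun Φ d(wtm)`**, `Φ_B = borelConstantTerm ν_N 𝓕 Φ` — the letter `hdis` of P2b-A (K2-defs1) with the extra binder `hΦm`.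
[cite: MoeglinWaldspurger1995, II.1.7–II.1.8] [cite: BernsteinLapid2019, §4 Claim 4 (p. 10)] -/
theorem integral_zFun_borelConstantTerm_eq_of_unfolding
    (νG : Measure (quasiSplit F E c N).Adelic) [νG.IsHaarMeasure]
    (νN : Measure ↥(adelicUnipotent F E c N)) [νN.IsHaarMeasure] [νN.IsInvInvariant]
    (hconj : ∀ b₀ (hb₀ : b₀ ∈ borelU (c : E →+* E) ((StdForm.antidiagonal N).over E)),
      νN.map (fun v : ↥(adelicUnipotent F E c N) => (⟨((quasiSplit F E c N).toAdelic b₀)⁻¹ * (v : (quasiSplit F E c N).Adelic) * (quasiSplit F E c N).toAdelic b₀,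
        conj_mem_adelicUnipotent ((K2E1PseudoEisensteinConstantTermU.toAdelic_mem_borelAdelic_iff b₀).2 hb₀) v.2⟩ : ↥(adelicUnipotent F E c N))) = νN)
    {𝓕 : Set ↥(adelicUnipotent F E c N)} (h𝓕 : IsFundamentalDomain ↥(rationalUnipotent F E c N) 𝓕 νN) (h𝓕₀ : νN 𝓕 ≠ 0) (h𝓕top : νN 𝓕 ≠ ∞)
    {β : (quasiSplit F E c N).Adelic → ℝ≥0∞} (hβ : IsCoveringWeight ↥((arithmeticBorel F E c N).map (quasiSplit F E c N).arithmeticSubgroup.subtype) β)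
    {μZ : Measure (borelQuotient F E c N)}
    (hμZ : ∀ f : borelQuotient F E c N → ℝ≥0∞, Measurable f → ∫⁻ z, f z ∂μZ = ∫⁻ g, β g * f (toBorelQuotient F E c N g) ∂νG)
    (k : ℕ) (c₀ : ℝ≥0) {Φ : (quasiSplit F E c N).Adelic → ℂ} (hΦm : Measurable Φ)
    (hΦB : ∀ b ∈ ratBorelSubgroup F E c N, ∀ g : (quasiSplit F E c N).Adelic, Φ (b * g) = Φ g)
    (hint : Integrable (zFun F E c N Φ) (weightedTruncMeasure F E c N k c₀ μZ))
    (hint' : Integrable (zFun F E c N (borelConstantTerm νN 𝓕 Φ)) (weightedTruncMeasure F E c N k c₀ μZ)) :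
    ∫ z, zFun F E c N (borelConstantTerm νN 𝓕 Φ) z ∂(weightedTruncMeasure F E c N k c₀ μZ) = ∫ z, zFun F E c N Φ z ∂(weightedTruncMeasure F E c N k c₀ μZ) := by
  -- the two spellings of left-`B(F)`-invariance; `Φ_B` is left-`B(F)`-invariant too
  have hΦB' : ∀ b ∈ arithmeticBorel F E c N, ∀ x : (quasiSplit F E c N).Adelic, Φ ((b : (quasiSplit F E c N).Adelic) * x) = Φ x :=
    fun b hb x => hΦB _ ⟨(mem_arithmeticBorel_iff b).1 hb, b.2⟩ x
  have hcB : ∀ b ∈ ratBorelSubgroup F E c N, ∀ g : (quasiSplit F E c N).Adelic, borelConstantTerm νN 𝓕 Φ (b * g) = borelConstantTerm νN 𝓕 Φ g := by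
    intro b hb g
    exact borelConstantTerm_rational_borel_mul νN h𝓕 hΦB' ⟨b, hb.2⟩ ((mem_arithmeticBorel_iff _).2 hb.1) g
  -- unfold both sides to `𝔾`
  rw [integral_weightedTruncMeasure_eq_of_unfolding νG hβ hμZ k c₀ hint'.aestronglyMeasurable,
    integral_weightedTruncMeasure_eq_of_unfolding νG hβ hμZ k c₀ hint.aestronglyMeasurable]
  simp only [zFun_toBorelQuotient F E c N hcB, zFun_toBorelQuotient F E c N hΦB, indicator_heightPow_smul_apply]
  -- pull-out: `H^{−2k} • 𝟙 Φ_B = (H^{−2k} • 𝟙 Φ)_B`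
  have hpt : ∀ g : (quasiSplit F E c N).Adelic,
      (β g).toReal • ((((borelHeight g)⁻¹ ^ (2 * k) : ℝ≥0) : ℝ) • {y : (quasiSplit F E c N).Adelic | c₀ < borelHeight y}.indicator (borelConstantTerm νN 𝓕 Φ) g) =
        (β g).toReal • borelConstantTerm νN 𝓕 (fun y => (((borelHeight y)⁻¹ ^ (2 * k) : ℝ≥0) : ℝ) • {y : (quasiSplit F E c N).Adelic | c₀ < borelHeight y}.indicator Φ y) g :=
    fun g => by rw [borelConstantTerm_heightPow_smul_indicator]
  simp only [hpt]
  -- ★ AVG for `F := H^{−2k} • 𝟙_{c<H} Φ`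
  have hH : Measurable (borelHeight : (quasiSplit F E c N).Adelic → ℝ≥0) := continuous_borelHeight.measurable
  have hFm : Measurable fun y : (quasiSplit F E c N).Adelic =>
      (((borelHeight y)⁻¹ ^ (2 * k) : ℝ≥0) : ℝ) • {y : (quasiSplit F E c N).Adelic | c₀ < borelHeight y}.indicator Φ y :=
    (hH.inv.pow_const _).coe_nnreal_real.smul (hΦm.indicator (measurableSet_lt measurable_const hH))
  have hFB : ∀ b ∈ arithmeticBorel F E c N, ∀ x : (quasiSplit F E c N).Adelic,
      (((borelHeight ((b : (quasiSplit F E c N).Adelic) * x))⁻¹ ^ (2 * k) : ℝ≥0) : ℝ) •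
          {y : (quasiSplit F E c N).Adelic | c₀ < borelHeight y}.indicator Φ ((b : (quasiSplit F E c N).Adelic) * x) =
        (((borelHeight x)⁻¹ ^ (2 * k) : ℝ≥0) : ℝ) • {y : (quasiSplit F E c N).Adelic | c₀ < borelHeight y}.indicator Φ x := by
    intro b hb x
    have hHb : borelHeight ((b : (quasiSplit F E c N).Adelic) * x) = borelHeight x := borelHeight_arithmeticBorel_mul' hb x
    rw [hHb]
    congr 1
    by_cases hx : x ∈ {y : (quasiSplit F E c N).Adelic | c₀ < borelHeight y}
    · have hbx : (b : (quasiSplit F E c N).Adelic) * x ∈ {y : (quasiSplit F E c N).Adelic | c₀ < borelHeight y} := by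
        show c₀ < borelHeight _
        rw [hHb]
        exact hx
      rw [Set.indicator_of_mem hbx, Set.indicator_of_mem hx, hΦB' b hb x]
    · have hbx : (b : (quasiSplit F E c N).Adelic) * x ∉ {y : (quasiSplit F E c N).Adelic | c₀ < borelHeight y} := by
        show ¬ c₀ < borelHeight _
        rw [hHb]
        exact hx
      rw [Set.indicator_of_notMem hbx, Set.indicator_of_notMem hx]
  exact integral_wt_smul_borelConstantTerm_eq_of νG νN hconj h𝓕 h𝓕₀ h𝓕top hβ hFm hFB
    (lintegral_wt_mul_enorm_truncWeightReal_smul_lt_top νG hβ hμZ k c₀ hΦB hint)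

end Summit.HodgeConjecture.HodgeConjecture.Cruxes.H413.K2E1BLFibreAverageInvarianceU

end
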